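import Mathlib
import HarnessLib
import Literature.Combinatorics.Additive.KempermanStructureTheoremNecessity

/-!
# The Kemperman Structure Theorem with Grynkiewicz's condition (iii)

[cite: Grynkiewicz2009, §2 (KST, conditions (i)–(iv))] [cite: Grynkiewicz2005, §2 (KST I, (c.10), Prop 2.2)]
[tag: critical-pair] [tag: inverse-theorem]

Topic `Literature/Combinatorics/Additive`.  Cell `mm-stpp` (D-0046), seat `mm-stpp-lit` (gen 24); the
port of D. J. Grynkiewicz, *A step beyond Kemperman's structure theorem*, Mathematika **55** (2009)
67–114 continued.  The tree's Kemperman Structure Theorem (`exists_isKempermanDecompI`,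
`KempermanStructureTheoremNecessity.lean`) is Kemperman's own form (Acta Math. 1960, Thm 5.1:
conditions (i), (ii), (iv) — structure `IsKempermanDecompI`).  Grynkiewicz 2009 states KST (print p. 4)
with one more condition:

«**Kemperman Structure Theorem (KST).** Let `G` be a finite abelian group, and let `A, B ⊆ G` be finite
and nonempty.  Now `|A + B| = |A| + |B| − 1` and either `A + B` is aperiodic or contains a unique
expression element if and only if there exist quasi-periodic decompositions `A = A₁ ∪ A₀` and
`B = B₁ ∪ B₀` with common quasi-period `H` and `A₀` and `B₀` nonempty, such that: (i) `φ_H(A₀) + φ_H(B₀)`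
is a unique expression element in `φ_H(A) + φ_H(B)`; (ii) `|φ_H(A + B)| = |φ_H(A)| + |φ_H(B)| − 1`;
(iii) if `a + b ∈ A + B` is a unique expression element with `a ∈ A` and `b ∈ B`, then `a ∈ A₀` and
`b ∈ B₀`; (iv) `(A₀, B₀)` is an elementary pair of type (I), (II), (III) or (IV).  Condition (iii) was
not stated in Kemperman's original paper, but can be derived from KST as shown in [10] [11].»

This file derives (iii): the «only if» half of KST in Grynkiewicz's form (structure `IsKempermanDecomp`
of `KempermanElementaryPairs.lean`, whose field `mem_of_unique` is (iii)), for finite `G` —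
`exists_isKempermanDecomp` — following [10] = Grynkiewicz 2005, §2: observation (c.10) («if
`ν_c(A, B) = 1` for `c = a + b` with `a ∈ A` and `b ∈ B₁`, or if `η_b(B, A) ≥ 2` for some `b ∈ A`, then
`(A, B)` must have type (I) with `|A₀| = 1`») and the argument of Proposition 2.2 («apply KST modulo
`H_a` … Note that `η_b(A, B) > 0` for `b ∈ B` implies `η_{φ_a(b)}(φ_a(A), φ_a(B)) > 0`.  Hence, in view of
KST(i), and since `η_{b₀}(A, B) > 0` for some `b₀ ∈ B₁`, it follows that `η_{φ_a(a₀)}(φ_a(B), φ_a(A)) ≥ 2`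
… Hence from (c.10) it follows that `φ_a(A)` must have type (I) with `A₀′ = A₀`, implying that
`A₁′ = A₁`»).  Where the print iterates to a maximal quasi-period («yielding an infinite chain of strictly
increasing subgroups … impossible»), we run a strong induction on `|G|`: KST with (iii) in the quotient
`G ⧸ H` (a smaller group) is applied to `(φ_H(A), φ_H(B))`, and its decomposition is LIFTED back to `G`
(flagged deviation; same mathematics, the induction replaces the maximality bookkeeping).

THE ARGUMENT.  Let `(H; A₁, A₀, B₁, B₀)` be a decomposition in Kemperman's form.  A unique expression
element `a + b` cannot have `a ∈ A₁` and `b ∈ B₁` (it would have `|H| ≥ 2` representations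
`(a + h) + (b − h)`); if `a ∈ A₁` then `B₀ = {b}` (`right_eq_singleton_of_unique`, (c.10)); so (iii)
fails only when, up to symmetry, `A₀ = {a₀}`, `b₀ ∈ B₁` and `a₀ + b₀` is uniquely expressed.  Then in
`G ⧸ H` the pair `(φ_H(A), φ_H(B))` is critical ((ii)) with the unique expression element
`φ_H(A₀) + φ_H(B₀)` ((i)); unique expression passes to the quotient
(`addConvolution_image_mk_eq_one`), so `φ_H(a₀)` is the `A`-summand of the two distinct unique expression
elements `φ_H(a₀) + φ_H(b₀)` and `φ_H(a₀) + φ_H(B₀)`; for a decomposition WITH (iii) this forces the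
bottom `A`-part to be `{φ_H(a₀)}` (`IsKempermanDecomp.left_eq_singleton_of_two_unique`, (c.10) second
clause — type (II) bottoms have their two unique expression elements at opposite ends,
`IsElementaryII.false_of_two_unique`).  The decomposition of `(φ_H(A), φ_H(B))` with quasi-period
`N̄ ≤ G ⧸ H` then lifts to one of `(A, B)` with quasi-period `N = φ_H⁻¹(N̄)`, periodic parts `A₁` and
`{b ∈ B : φ_H(b) ∈ B̄₁}`, bottom pair `({a₀}, {b ∈ B : φ_H(b) ∈ B̄₀})` of type (I), and (i)–(iii)
inherited (`exists_isKempermanDecomp_lift`).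

MAIN RESULTS (0 definitions, 0 named facts; everything PROVED).
* `IsKempermanDecompI.right_eq_singleton_of_unique`, `IsKempermanDecompI.addConvolution_image_mk_eq_one`,
  `IsElementaryII.false_of_two_unique`, `IsKempermanDecomp.left_eq_singleton_of_two_unique`.
* `card_image_eq_of_forall_iff`, `cosetCount_comap_mk` (`|φ_N(X)| = |φ_{N̄}(φ_H(X))|` for `N = φ_H⁻¹(N̄)`).
* `IsKempermanDecompI.exists_isKempermanDecomp_lift` (the lift) and
  **`exists_isKempermanDecomp`**: KST, «only if» half, WITH (iii), finite nontrivial abelian `G`.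

WHAT THIS IS NOT.  Not the infinite-group statement; not Grynkiewicz 2005's Proposition 2.2 itself
(the canonical decomposition for type (I)) nor the uniqueness assertions (c.13)/(c.15).  Census-silent
for the cell `mm-stpp`.

## References
* D. J. Grynkiewicz, *A step beyond Kemperman's structure theorem*, Mathematika 55 (2009) 67–114,
  doi:10.1112/S0025579300000966, §2 p. 70 (KST with (iii)) [cite: Grynkiewicz2009, §2 (KST)] — held
  `paper:doi-10-1112-s0025579300000966`, p0004 read 2026-08-29.
* D. J. Grynkiewicz, *Quasi-periodic decompositions and the Kemperman structure theorem*, European J.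
  Combin. 26 (2005) 559–575, doi:10.1016/j.ejc.2004.06.011, §2 ((c.10), Proposition 2.2 and its proof)
  [cite: Grynkiewicz2005, §2 ((c.10), Prop 2.2)] — held `paper:doi-10-1016-j-ejc-2004-06-011`,
  p0007–p0009 read 2026-08-29.
* J. H. B. Kemperman, *On small sumsets in an abelian group*, Acta Math. 103 (1960) 63–88, Thm 5.1
  [cite: Kemperman1960, Thm 5.1].
-/

namespace Literature.Combinatorics.Additive

open Finset
open scoped Pointwise

universe u

variable {G : Type u} [AddCommGroup G] [DecidableEq G]

/-! ### Where a unique expression element sits (Grynkiewicz 2005, (c.10)) -/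

namespace IsKempermanDecompI

variable {H : AddSubgroup G} {A B A₁ A₀ B₁ B₀ : Finset G}

/-- **(c.10), first clause (Kemperman form).**  If `a + b` is a unique expression element of `A + B`
with `a` in the periodic part `A₁`, then `B₀ = {b}`: `b ∈ B₁` would give the `|H| ≥ 2`
representations `(a + h) + (b − h)`, and every `b' ∈ B₀` gives the representation
`(a + (b − b')) + b'`. [cite: Grynkiewicz2005, §2 (c.10)] -/
theorem right_eq_singleton_of_unique (h : IsKempermanDecompI H A B A₁ A₀ B₁ B₀) {a b : G}
    (ha : a ∈ A₁) (hb : b ∈ B) (hu : A.addConvolution B (a + b) = 1) : B₀ = {b} := by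
  have hA₁A : A₁ ⊆ A := h.decomp_left.left_subset
  have huniq := (addConvolution_add_eq_one_iff (hA₁A ha) hb).1 hu
  have hbB : b ∈ B₁ ∪ B₀ := by rw [h.decomp_right.union_eq]; exact hb
  have hb₀ : b ∈ B₀ := by
    rcases mem_union.1 hbB with hb₁ | hb₀
    · exfalso
      obtain ⟨g, hgH, hg0⟩ : ∃ g ∈ H, g ≠ (0 : G) := by
        by_contra hno
        push Not at hno
        exact h.decomp_left.ne_bot ((AddSubgroup.eq_bot_iff_forall _).2 hno)
      have h1 : g + a ∈ A := hA₁A (h.decomp_left.periodic.add_mem hgH ha)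
      have h2 : -g + b ∈ B :=
        h.decomp_right.left_subset (h.decomp_right.periodic.add_mem (H.neg_mem hgH) hb₁)
      have e := huniq (g + a) h1 (-g + b) h2 (by abel)
      exact hg0 (neg_eq_zero.1 (add_eq_right.1 e))
    · exact hb₀
  refine eq_singleton_iff_unique_mem.2 ⟨hb₀, fun b' hb' => ?_⟩
  have hbb' : b - b' ∈ H := h.decomp_right.sub_mem b hb₀ b' hb'
  have h1 : (b - b') + a ∈ A := hA₁A (h.decomp_left.periodic.add_mem hbb' ha)
  exact huniq _ h1 b' (h.decomp_right.right_subset hb') (by abel)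

/-- **Unique expression passes to the quotient by the quasi-period** («Note that `η_b(A, B) > 0` for
`b ∈ B` implies `η_{φ_a(b)}(φ_a(A), φ_a(B)) > 0`»): for a decomposition in Kemperman's form with
quasi-period `H`, if `u + v` (`u ∈ A`, `v ∈ B`) is a unique expression element of `A + B`, then
`φ_H(u) + φ_H(v)` is a unique expression element of `φ_H(A) + φ_H(B)`.  A representation
`φ_H(u') + φ_H(v')` has `u' + v' = u + v + m` with `m ∈ H`; if `v' ∈ B₁` or `u' ∈ A₁` the period `m`
is absorbed and uniqueness in `G` gives `v' ≡ v`; if `u' ∈ A₀`, `v' ∈ B₀` condition (i) does.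
[cite: Grynkiewicz2005, §2 (proof of Prop 2.2)] -/
theorem addConvolution_image_mk_eq_one (h : IsKempermanDecompI H A B A₁ A₀ B₁ B₀)
    [DecidableEq (G ⧸ H)] {u v : G} (hu : u ∈ A) (hv : v ∈ B)
    (h1 : A.addConvolution B (u + v) = 1) :
    (A.image (QuotientAddGroup.mk : G → G ⧸ H)).addConvolution
        (B.image (QuotientAddGroup.mk : G → G ⧸ H))
        ((QuotientAddGroup.mk u : G ⧸ H) + QuotientAddGroup.mk v) = 1 := by
  have huniq := (addConvolution_add_eq_one_iff hu hv).1 h1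
  rw [addConvolution_add_eq_one_iff (mem_image_of_mem _ hu) (mem_image_of_mem _ hv)]
  intro ξ hξ η hη he
  obtain ⟨u', hu', rfl⟩ := mem_image.1 hξ
  obtain ⟨v', hv', rfl⟩ := mem_image.1 hη
  rw [← QuotientAddGroup.mk_add, ← QuotientAddGroup.mk_add, QuotientAddGroup.eq_iff_sub_mem] at he
  rw [QuotientAddGroup.eq_iff_sub_mem]
  set m := u' + v' - (u + v) with hm
  have hv'B : v' ∈ B₁ ∪ B₀ := by rw [h.decomp_right.union_eq]; exact hv'
  rcases mem_union.1 hv'B with hv'₁ | hv'₀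
  · have hvm : -m + v' ∈ B :=
      h.decomp_right.left_subset (h.decomp_right.periodic.add_mem (H.neg_mem he) hv'₁)
    have e := huniq u' hu' (-m + v') hvm (by rw [hm]; abel)
    have e' : v' - v = m := by
      have : v = -m + v' := e.symm
      rw [this]; abel
    rw [e']; exact he
  · have hu'A : u' ∈ A₁ ∪ A₀ := by rw [h.decomp_left.union_eq]; exact hu'
    rcases mem_union.1 hu'A with hu'₁ | hu'₀
    · have hum : -m + u' ∈ A :=
        h.decomp_left.left_subset (h.decomp_left.periodic.add_mem (H.neg_mem he) hu'₁)
      have e := huniq (-m + u') hum v' hv' (by rw [hm]; abel)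
      rw [e, sub_self]; exact H.zero_mem
    · have hq := h.quot_unique u hu v hv u' hu'₀ v' hv'₀ (by
        have e : u + v - (u' + v') = -m := by rw [hm]; abel
        rw [e]; exact H.neg_mem he)
      have := H.neg_mem hq.2
      rwa [neg_sub] at this

end IsKempermanDecompI

/-- **Type (II): the two unique expression elements sit at opposite ends.**  In a type (II) pair
(`A = {a, …, a + (m−1)d}`, `B = {b, …, b + (n−1)d}`, `m, n ≥ 2`) an element `u + v` with `u = a + id`,
`v = b + jd` that is uniquely expressed has `(i = 0 ∨ j = n − 1)` and `(i = m − 1 ∨ j = 0)` (else shift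
one step of `d` between the summands); hence no `u ∈ A` is the `A`-summand of two distinct unique
expression elements («(II) implies that `|{c ∈ A + B | ν_c(A, B) = 1}| = 2`», the two ends).
[cite: Grynkiewicz2005, §2 ((c.8), (c.10))] -/
theorem IsElementaryII.false_of_two_unique {A B : Finset G} (hII : IsElementaryII A B) {u v v' : G}
    (hu : u ∈ A) (hv : v ∈ B) (hv' : v' ∈ B) (hne : v ≠ v')
    (h1 : A.addConvolution B (u + v) = 1) (h2 : A.addConvolution B (u + v') = 1) : False := by
  obtain ⟨hA2, hB2, d, ⟨a, hA⟩, ⟨b, hB⟩, -⟩ := hII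
  have hd : d ≠ 0 := IsElementaryII.ne_zero hA2 ⟨a, hA⟩
  have hu' : u ∈ apFinset a d #A := by rw [← hA]; exact hu
  obtain ⟨i, hi, hiu⟩ := mem_apFinset.1 hu'
  -- the end conditions for a unique expression element `u + w`
  have key : ∀ {w : G}, w ∈ B → A.addConvolution B (u + w) = 1 →
      ∃ j, j < #B ∧ b + j • d = w ∧ (i = 0 ∨ j + 1 = #B) ∧ (i + 1 = #A ∨ j = 0) := by
    intro w hw hw1
    have huniq := (addConvolution_add_eq_one_iff hu hw).1 hw1
    have hw' : w ∈ apFinset b d #B := by rw [← hB]; exact hw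
    obtain ⟨j, hj, hjw⟩ := mem_apFinset.1 hw'
    refine ⟨j, hj, hjw, ?_, ?_⟩
    · by_contra hno
      push Not at hno
      have hi1 : a + (i - 1) • d ∈ A := by
        rw [hA]; exact mem_apFinset.2 ⟨i - 1, by omega, rfl⟩
      have hj1 : b + (j + 1) • d ∈ B := by
        rw [hB]; exact mem_apFinset.2 ⟨j + 1, by omega, rfl⟩
      have hid : i • d = (i - 1) • d + d := by
        rw [← succ_nsmul]; congr 1; omega
      have e := huniq _ hi1 _ hj1 (by rw [← hiu, ← hjw, hid, succ_nsmul]; abel)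
      rw [← hjw, succ_nsmul] at e
      exact hd (add_eq_left.1 (add_left_cancel e))
    · by_contra hno
      push Not at hno
      have hi1 : a + (i + 1) • d ∈ A := by
        rw [hA]; exact mem_apFinset.2 ⟨i + 1, by omega, rfl⟩
      have hj1 : b + (j - 1) • d ∈ B := by
        rw [hB]; exact mem_apFinset.2 ⟨j - 1, by omega, rfl⟩
      have hjd : j • d = (j - 1) • d + d := by
        rw [← succ_nsmul]; congr 1; omega
      have e := huniq _ hi1 _ hj1 (by rw [← hiu, ← hjw, hjd, succ_nsmul]; abel)
      rw [← hjw, hjd] at e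
      exact hd (add_eq_left.1 (add_left_cancel e).symm)
  obtain ⟨j, -, hjv, hj1, hj2⟩ := key hv h1
  obtain ⟨j', -, hjv', hj1', hj2'⟩ := key hv' h2
  apply hne
  rw [← hjv, ← hjv']
  rcases Nat.eq_zero_or_pos i with hi0 | hipos
  · have hj0 : j = 0 := by rcases hj2 with h | h <;> omega
    have hj0' : j' = 0 := by rcases hj2' with h | h <;> omega
    rw [hj0, hj0']
  · have e1 : j + 1 = #B := by rcases hj1 with h | h <;> omega
    have e2 : j' + 1 = #B := by rcases hj1' with h | h <;> omega
    rw [show j = j' by omega]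

/-- **(c.10), second clause, for decompositions with (iii).**  If `a ∈ A` is the `A`-summand of two
distinct unique expression elements `a + b`, `a + b'` of `A + B`, then the bottom `A`-part of any
Kemperman decomposition in Grynkiewicz's form is `A₀ = {a}`: by (iii) `a ∈ A₀`, `b, b' ∈ B₀`, and the
bottom pair cannot be of type (II) (`IsElementaryII.false_of_two_unique`), (III) (one unique expression
element) or (IV) (none), nor of type (I) with `|B₀| = 1`. («if `η_b(B, A) ≥ 2` for some `b ∈ A`, then
`(A, B)` must have type (I) with `|A₀| = 1`».) [cite: Grynkiewicz2005, §2 (c.10)] -/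
theorem IsKempermanDecomp.left_eq_singleton_of_two_unique {H : AddSubgroup G}
    {A B A₁ A₀ B₁ B₀ : Finset G} (h : IsKempermanDecomp H A B A₁ A₀ B₁ B₀) {a b b' : G}
    (ha : a ∈ A) (hb : b ∈ B) (hb' : b' ∈ B) (hne : b ≠ b')
    (h1 : A.addConvolution B (a + b) = 1) (h2 : A.addConvolution B (a + b') = 1) : A₀ = {a} := by
  obtain ⟨ha₀, hb₀⟩ := h.mem_of_unique a ha b hb h1
  obtain ⟨-, hb'₀⟩ := h.mem_of_unique a ha b' hb' h2
  have hsubA : A₀ ⊆ A := h.decomp_left.right_subset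
  have hsubB : B₀ ⊆ B := h.decomp_right.right_subset
  have restrict : ∀ {w : G}, w ∈ B₀ → A.addConvolution B (a + w) = 1 →
      A₀.addConvolution B₀ (a + w) = 1 := by
    intro w hw hw1
    apply le_antisymm
    · rw [← hw1]; exact addConvolution_mono hsubA hsubB _
    · exact addConvolution_pos.2 (add_mem_add ha₀ hw)
  have h1' := restrict hb₀ h1
  have h2' := restrict hb'₀ h2
  rcases h.elementary with hI | hII | hIII | hIV
  · rcases hI.2.2 with hA1 | hB1
    · obtain ⟨x, hx⟩ := card_eq_one.1 hA1
      rw [hx] at ha₀ ⊢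
      rw [mem_singleton.1 ha₀]
    · exfalso
      obtain ⟨y, hy⟩ := card_eq_one.1 hB1
      rw [hy, mem_singleton] at hb₀ hb'₀
      exact hne (hb₀.trans hb'₀.symm)
  · exact (hII.false_of_two_unique ha₀ hb₀ hb'₀ hne h1' h2').elim
  · exfalso
    obtain ⟨K, a₃, b₃, -, -, -, -, -, huniq⟩ := hIII
    have e1 := (huniq _).1 h1'
    have e2 := (huniq _).1 h2'
    exact hne (add_left_cancel (e1.trans e2.symm))
  · exfalso
    obtain ⟨K, a₄, b₄, g, -, -, -, -, hno, -⟩ := hIV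
    exact hno _ h1'

/-! ### Counting cosets through a quotient -/

/-- Two maps that identify the same pairs of points of `X` have images of the same size.
[folklore] -/
private theorem card_image_le_of_forall_imp {α β γ : Type*} [DecidableEq β] [DecidableEq γ]
    (X : Finset α) (f : α → β) (g : α → γ) (h : ∀ x ∈ X, ∀ y ∈ X, g x = g y → f x = f y) :
    #(X.image f) ≤ #(X.image g) := by
  rcases X.eq_empty_or_nonempty with rfl | ⟨x₀, -⟩
  · simp
  haveI : Nonempty α := ⟨x₀⟩
  -- choose a preimage for every point of `X.image f`
  have hpre : ∀ z ∈ X.image f, ∃ x ∈ X, f x = z := fun z hz => by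
    obtain ⟨x, hx, rfl⟩ := mem_image.1 hz; exact ⟨x, hx, rfl⟩
  choose! s hs using hpre
  refine card_le_card_of_injOn (fun z => g (s z)) (fun z hz => ?_) (fun z₁ hz₁ z₂ hz₂ he => ?_)
  · exact mem_coe.2 (mem_image_of_mem _ (hs z (mem_coe.1 hz)).1)
  · have h₁ := hs z₁ (mem_coe.1 hz₁)
    have h₂ := hs z₂ (mem_coe.1 hz₂)
    rw [← h₁.2, ← h₂.2]
    exact h _ h₁.1 _ h₂.1 he

/-- `|X.image f| = |X.image g|` when `f x = f y ↔ g x = g y` on `X`. [cite: Grynkiewicz2009, §2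
(φ_H notation)] -/
theorem card_image_eq_of_forall_iff {α β γ : Type*} [DecidableEq β] [DecidableEq γ]
    (X : Finset α) (f : α → β) (g : α → γ) (h : ∀ x ∈ X, ∀ y ∈ X, f x = f y ↔ g x = g y) :
    #(X.image f) = #(X.image g) :=
  le_antisymm (card_image_le_of_forall_imp X f g fun x hx y hy => (h x hx y hy).2)
    (card_image_le_of_forall_imp X g f fun x hx y hy => (h x hx y hy).1)

omit [DecidableEq G] in
/-- `φ_H(A + B) = φ_H(A) + φ_H(B)`. [cite: Grynkiewicz2009, §2 (notation φ_H)] -/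
theorem image_mk_add_eq (H : AddSubgroup G) [DecidableEq G] [DecidableEq (G ⧸ H)] (A B : Finset G) :
    (A + B).image (QuotientAddGroup.mk : G → G ⧸ H) =
      A.image (QuotientAddGroup.mk : G → G ⧸ H) + B.image (QuotientAddGroup.mk : G → G ⧸ H) := by
  rw [← QuotientAddGroup.coe_mk', image_add]

omit [DecidableEq G] in
/-- **`|φ_N(X)| = |φ_{N̄}(φ_H(X))|`** for a subgroup `N̄ ≤ G ⧸ H` and its preimage `N = φ_H⁻¹(N̄)`
(the third isomorphism theorem at the level of coset counts). [cite: Grynkiewicz2009, §2 («repeated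
application of KST modulo the quasi-period … a chain of subgroups»)] -/
theorem cosetCount_comap_mk (H : AddSubgroup G) [DecidableEq (G ⧸ H)] (N' : AddSubgroup (G ⧸ H))
    (X : Finset G) :
    cosetCount (N'.comap (QuotientAddGroup.mk' H)) X =
      cosetCount N' (X.image (QuotientAddGroup.mk : G → G ⧸ H)) := by
  haveI : DecidableEq ((G ⧸ H) ⧸ N') := Classical.decEq _
  haveI : DecidableEq (G ⧸ N'.comap (QuotientAddGroup.mk' H)) := Classical.decEq _
  rw [cosetCount_eq_card_image, cosetCount_eq_card_image, image_image]
  refine card_image_eq_of_forall_iff X _ _ fun x _ y _ => ?_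
  rw [QuotientAddGroup.eq_iff_sub_mem, Function.comp_apply, Function.comp_apply,
    QuotientAddGroup.eq_iff_sub_mem, AddSubgroup.mem_comap, QuotientAddGroup.mk'_apply,
    QuotientAddGroup.mk_sub]

/-! ### The lift (Grynkiewicz 2005, proof of Proposition 2.2) -/

omit [DecidableEq G] in
/-- A finite set closed under adding elements of `N` is `N`-periodic. [folklore] -/
private theorem isPeriodicWith_of_forall_add_mem' [DecidableEq G] {N : AddSubgroup G} {X : Finset G}
    (h : ∀ n ∈ N, ∀ x ∈ X, n + x ∈ X) : IsPeriodicWith N X := by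
  intro n hn
  apply eq_of_subset_of_card_le
  · intro y hy
    obtain ⟨x, hx, rfl⟩ := mem_vadd_finset.1 hy
    exact h n hn x hx
  · rw [card_vadd_finset]

namespace IsKempermanDecompI

variable {H : AddSubgroup G} {A B A₁ A₀ B₁ B₀ : Finset G}

/-- **The lift.**  Let `(H; A₁, {a₀}, B₁, B₀)` be a Kemperman decomposition of `(A, B)` in Kemperman's
form, `b₀ ∈ B₁` with `a₀ + b₀` uniquely expressed, and let `(N̄; Ā₁, Ā₀, B̄₁, B̄₀)` be a Kemperman
decomposition WITH (iii) of `(φ_H(A), φ_H(B))` in `G ⧸ H`.  Then `Ā₀ = {φ_H(a₀)}` (so `Ā₁ = φ_H(A₁)`),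
and with `N = φ_H⁻¹(N̄)`, `B₁' = {b ∈ B : φ_H(b) ∈ B̄₁}`, `B₀' = {b ∈ B : φ_H(b) ∈ B̄₀}` the data
`(N; A₁, {a₀}, B₁', B₀')` is a Kemperman decomposition of `(A, B)` in Grynkiewicz's form (bottom pair
of type (I); (i), (ii) read off in `(G ⧸ H) ⧸ N̄`; (iii) by `addConvolution_image_mk_eq_one` and (iii)
upstairs).  («Hence from (c.10) it follows that `φ_a(A)` must have type (I) with `A₀′ = A₀`, implying
that `A₁′ = A₁` … `B₁′` is `H_{a′}`-periodic … a pair of quasi-periodic decompositions that satisfies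
KST with quasi-period `H_{a′}`».) [cite: Grynkiewicz2005, §2 (proof of Prop 2.2)] -/
theorem exists_isKempermanDecomp_lift (h : IsKempermanDecompI H A B A₁ A₀ B₁ B₀) {a₀ b₀ : G}
    (hA₀ : A₀ = {a₀}) (hb₀ : b₀ ∈ B₁) (hu : A.addConvolution B (a₀ + b₀) = 1)
    [DecidableEq (G ⧸ H)] {N' : AddSubgroup (G ⧸ H)} {X₁ X₀ Y₁ Y₀ : Finset (G ⧸ H)}
    (hq : IsKempermanDecomp N' (A.image (QuotientAddGroup.mk : G → G ⧸ H))
      (B.image (QuotientAddGroup.mk : G → G ⧸ H)) X₁ X₀ Y₁ Y₀) :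
    ∃ (N : AddSubgroup G) (B₁' B₀' : Finset G), IsKempermanDecomp N A B A₁ {a₀} B₁' B₀' := by
  set π : G → G ⧸ H := QuotientAddGroup.mk with hπ
  have ha₀A₀ : a₀ ∈ A₀ := by rw [hA₀]; exact mem_singleton_self _
  have ha₀ : a₀ ∈ A := h.decomp_left.right_subset ha₀A₀
  have hb₀B : b₀ ∈ B := h.decomp_right.left_subset hb₀
  obtain ⟨β₀, hβ₀⟩ := h.right_nonempty
  have hβ₀B : β₀ ∈ B := h.decomp_right.right_subset hβ₀
  -- the two unique expression elements with `A`-summand `φ(a₀)`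
  have hu1 : (A.image π).addConvolution (B.image π) (π a₀ + π b₀) = 1 :=
    h.addConvolution_image_mk_eq_one ha₀ hb₀B hu
  have hu2 : (A.image π).addConvolution (B.image π) (π a₀ + π β₀) = 1 := by
    rw [hπ, ← QuotientAddGroup.mk_add]
    exact (quot_unique_iff_addConvolution_image h.decomp_left h.decomp_right ha₀A₀ hβ₀).1
      h.quot_unique
  have hne : π b₀ ≠ π β₀ := fun e =>
    h.decomp_right.sub_notMem hb₀ hβ₀ (QuotientAddGroup.eq_iff_sub_mem.1 e)
  have hX₀ : X₀ = {π a₀} :=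
    hq.left_eq_singleton_of_two_unique (mem_image_of_mem _ ha₀) (mem_image_of_mem _ hb₀B)
      (mem_image_of_mem _ hβ₀B) hne hu1 hu2
  -- the new quasi-period and the new parts of `B`
  set N : AddSubgroup G := N'.comap (QuotientAddGroup.mk' H) with hNdef
  have hmemN : ∀ g, g ∈ N ↔ π g ∈ N' := fun g => by
    rw [hNdef, AddSubgroup.mem_comap]; rfl
  have hHN : H ≤ N := fun g hg => by
    rw [hmemN]
    have e : π g = 0 := (QuotientAddGroup.eq_zero_iff g).2 hg
    rw [e]; exact N'.zero_mem
  set B₁' := B.filter (fun b => π b ∈ Y₁) with hB₁'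
  set B₀' := B.filter (fun b => π b ∈ Y₀) with hB₀'
  -- every element of `B₀` maps into `Y₀`
  have hπβ₀ : π β₀ ∈ Y₀ := (hq.mem_of_unique _ (mem_image_of_mem _ ha₀) _ (mem_image_of_mem _ hβ₀B) hu2).2
  have hB₀Y₀ : ∀ b ∈ B₀, π b ∈ Y₀ := fun b hb => by
    have : π b = π β₀ := QuotientAddGroup.eq_iff_sub_mem.2 (h.decomp_right.sub_mem b hb β₀ hβ₀)
    rw [this]; exact hπβ₀
  -- `A₁` maps into `X₁`
  have hA₁X₁ : ∀ a ∈ A₁, π a ∈ X₁ := fun a ha => by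
    have hπa : π a ∈ X₁ ∪ X₀ := by
      rw [hq.decomp_left.union_eq]; exact mem_image_of_mem _ (h.decomp_left.left_subset ha)
    rcases mem_union.1 hπa with h1 | h0
    · exact h1
    · exfalso
      rw [hX₀, mem_singleton, QuotientAddGroup.eq_iff_sub_mem] at h0
      exact h.decomp_left.sub_notMem ha ha₀A₀ h0
  refine ⟨N, B₁', B₀', ?_⟩
  refine
    { decomp_left := ?_
      decomp_right := ?_
      left_nonempty := singleton_nonempty _
      right_nonempty := ⟨β₀, mem_filter.2 ⟨hβ₀B, hπβ₀⟩⟩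
      quot_unique := ?_
      cosetCount_add := ?_
      mem_of_unique := ?_
      elementary := Or.inl ⟨singleton_nonempty _, ⟨β₀, mem_filter.2 ⟨hβ₀B, hπβ₀⟩⟩,
        Or.inl (card_singleton _)⟩ }
  · -- `A = A₁ ∪ {a₀}` with quasi-period `N`
    refine ⟨fun hN => h.decomp_left.ne_bot (le_bot_iff.1 (hHN.trans (le_of_eq hN))),
      by rw [← hA₀]; exact h.decomp_left.disjoint, by rw [← hA₀]; exact h.decomp_left.union_eq, ?_,
      fun x hx y hy => by rw [mem_singleton] at hx hy; rw [hx, hy, sub_self]; exact N.zero_mem⟩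
    refine isPeriodicWith_of_forall_add_mem' fun n hn a ha => ?_
    have hπna : π (n + a) ∈ X₁ := by
      rw [hπ, QuotientAddGroup.mk_add]
      exact hq.decomp_left.periodic.add_mem ((hmemN n).1 hn) (hA₁X₁ a ha)
    have hπnaA : π (n + a) ∈ A.image π := hq.decomp_left.left_subset hπna
    obtain ⟨a', ha', he⟩ := mem_image.1 hπnaA
    have ha'A : a' ∈ A₁ ∪ A₀ := by rw [h.decomp_left.union_eq]; exact ha'
    rcases mem_union.1 ha'A with ha'₁ | ha'₀
    · -- `n + a = (n + a - a') + a'` with `n + a - a' ∈ H`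
      have hm : (n + a) - a' ∈ H := by
        rw [← QuotientAddGroup.eq_iff_sub_mem]; exact he.symm
      have := h.decomp_left.periodic.add_mem hm ha'₁
      rwa [sub_add_cancel] at this
    · exfalso
      rw [hA₀, mem_singleton] at ha'₀
      rw [ha'₀] at he
      have : π (n + a) ∈ X₀ := by rw [hX₀, ← he]; exact mem_singleton_self _
      exact disjoint_left.1 hq.decomp_left.disjoint hπna this
  · -- `B = B₁' ∪ B₀'` with quasi-period `N`
    refine ⟨fun hN => h.decomp_left.ne_bot (le_bot_iff.1 (hHN.trans (le_of_eq hN))), ?_, ?_, ?_, ?_⟩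
    · rw [hB₁', hB₀', disjoint_filter]
      intro b _ hb1 hb0
      exact disjoint_left.1 hq.decomp_right.disjoint hb1 hb0
    · rw [hB₁', hB₀', ← filter_or]
      refine (filter_eq_self).2 fun b hb => ?_
      rw [← mem_union, hq.decomp_right.union_eq]; exact mem_image_of_mem _ hb
    · refine isPeriodicWith_of_forall_add_mem' fun n hn b hb => ?_
      rw [hB₁', mem_filter] at hb ⊢
      have hπnb : π (n + b) ∈ Y₁ := by
        rw [hπ, QuotientAddGroup.mk_add]
        exact hq.decomp_right.periodic.add_mem ((hmemN n).1 hn) hb.2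
      have hπnbB : π (n + b) ∈ B.image π := hq.decomp_right.left_subset hπnb
      obtain ⟨b', hb', he⟩ := mem_image.1 hπnbB
      have hb'B : b' ∈ B₁ ∪ B₀ := by rw [h.decomp_right.union_eq]; exact hb'
      rcases mem_union.1 hb'B with hb'₁ | hb'₀
      · have hm : (n + b) - b' ∈ H := by
          rw [← QuotientAddGroup.eq_iff_sub_mem]; exact he.symm
        have := h.decomp_right.periodic.add_mem hm hb'₁
        rw [sub_add_cancel] at this
        exact ⟨h.decomp_right.left_subset this, hπnb⟩
      · exfalso
        have : π (n + b) ∈ Y₀ := by rw [← he]; exact hB₀Y₀ b' hb'₀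
        exact disjoint_left.1 hq.decomp_right.disjoint hπnb this
    · intro x hx y hy
      rw [hB₀', mem_filter] at hx hy
      rw [hmemN, hπ, QuotientAddGroup.mk_sub]
      exact hq.decomp_right.sub_mem _ hx.2 _ hy.2
  · -- (i)
    intro a ha b hb a₀' ha₀' b' hb' hab
    rw [mem_singleton] at ha₀'
    rw [hB₀', mem_filter] at hb'
    rw [hmemN, hπ, QuotientAddGroup.mk_sub, QuotientAddGroup.mk_add, QuotientAddGroup.mk_add] at hab
    have hq' := hq.quot_unique _ (mem_image_of_mem _ ha) _ (mem_image_of_mem _ hb) _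
      (by rw [hX₀, ha₀']; exact mem_singleton_self _) _ hb'.2 hab
    rw [hmemN, hmemN, hπ, QuotientAddGroup.mk_sub, QuotientAddGroup.mk_sub]
    exact hq'
  · -- (ii)
    have := hq.cosetCount_add
    rw [← image_mk_add_eq H A B, ← cosetCount_comap_mk, ← cosetCount_comap_mk,
      ← cosetCount_comap_mk] at this
    exact this
  · -- (iii)
    intro a ha b hb h1
    have h1' := h.addConvolution_image_mk_eq_one ha hb h1
    obtain ⟨hπa, hπb⟩ := hq.mem_of_unique _ (mem_image_of_mem _ ha) _ (mem_image_of_mem _ hb) h1'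
    refine ⟨?_, mem_filter.2 ⟨hb, hπb⟩⟩
    rw [hX₀, mem_singleton, QuotientAddGroup.eq_iff_sub_mem] at hπa
    rw [← hA₀]
    exact h.decomp_left.mem_right_of_sub_mem ha ha₀A₀ hπa

end IsKempermanDecompI

/-! ### KST with (iii) -/

/-- **THE KEMPERMAN STRUCTURE THEOREM, «only if» half, with Grynkiewicz's condition (iii)** (print
p. 4, quoted in the module docstring): in a finite nontrivial abelian group, if `A, B ≠ ∅`,
`|A + B| = |A| + |B| − 1`, and `A + B` is aperiodic or has a unique expression element, then there are
quasi-periodic decompositions `A = A₁ ∪ A₀`, `B = B₁ ∪ B₀` with a common quasi-period `H`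
(`A₀, B₀ ≠ ∅`) satisfying (i), (ii), **(iii)** («if `a + b ∈ A + B` is a unique expression element with
`a ∈ A` and `b ∈ B`, then `a ∈ A₀` and `b ∈ B₀`») and (iv) — `IsKempermanDecomp`.  PROOF: strong
induction on `|G|`; Kemperman's form from `exists_isKempermanDecompI`; if (iii) fails then (up to the
symmetry `A ↔ B`) `A₀ = {a₀}` and some `b₀ ∈ B₁` has `a₀ + b₀` uniquely expressed
(`right_eq_singleton_of_unique`); the induction hypothesis in `G ⧸ H` and
`exists_isKempermanDecomp_lift` finish. («Condition (iii) … can be derived from KST as shown in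
[10] [11]».) [cite: Grynkiewicz2009, §2 (KST (i)–(iv))] [cite: Grynkiewicz2005, §2 ((c.10), Prop 2.2)] -/
theorem exists_isKempermanDecomp [Fintype G] [Nontrivial G] {A B : Finset G} (hA : A.Nonempty)
    (hB : B.Nonempty) (hcrit : #(A + B) + 1 = #A + #B)
    (hyp : ¬ IsPeriodic (A + B) ∨ ∃ c, A.addConvolution B c = 1) :
    ∃ (H : AddSubgroup G) (A₁ A₀ B₁ B₀ : Finset G), IsKempermanDecomp H A B A₁ A₀ B₁ B₀ := by
  -- strong induction on the order of the group
  suffices key : ∀ (n : ℕ) (K : Type u) [AddCommGroup K] [Fintype K] [DecidableEq K] [Nontrivial K],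
      Fintype.card K = n → ∀ {A B : Finset K}, A.Nonempty → B.Nonempty → #(A + B) + 1 = #A + #B →
      (¬ IsPeriodic (A + B) ∨ ∃ c, A.addConvolution B c = 1) →
      ∃ (H : AddSubgroup K) (A₁ A₀ B₁ B₀ : Finset K), IsKempermanDecomp H A B A₁ A₀ B₁ B₀ from
    key _ G rfl hA hB hcrit hyp
  intro n
  induction n using Nat.strong_induction_on with
  | _ n ih => ?_
  intro K _ _ _ _ hn A B hA hB hcrit hyp
  -- one step: from a failure of (iii) in the mode `A₀ = {a₀}`, `b₀ ∈ B₁`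
  have step : ∀ {A B : Finset K} {H : AddSubgroup K} {A₁ A₀ B₁ B₀ : Finset K} {a₀ b₀ : K},
      IsKempermanDecompI H A B A₁ A₀ B₁ B₀ → A₀ = {a₀} → b₀ ∈ B₁ →
      A.addConvolution B (a₀ + b₀) = 1 →
      ∃ (N : AddSubgroup K) (X₁ X₀ Y₁ Y₀ : Finset K), IsKempermanDecomp N A B X₁ X₀ Y₁ Y₀ := by
    intro A B H A₁ A₀ B₁ B₀ a₀ b₀ h hA₀ hb₀ hu
    haveI : DecidableEq (K ⧸ H) := Classical.decEq _
    haveI : Fintype (K ⧸ H) := Fintype.ofFinite _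
    have ha₀A₀ : a₀ ∈ A₀ := by rw [hA₀]; exact mem_singleton_self _
    have hAne : A.Nonempty := ⟨a₀, h.decomp_left.right_subset (by rw [hA₀]; exact mem_singleton_self _)⟩
    have hBne : B.Nonempty := ⟨b₀, h.decomp_right.left_subset hb₀⟩
    obtain ⟨β₀, hβ₀⟩ := h.right_nonempty
    -- `H ≠ ⊤`: `β₀ ∈ B₀` is not in the `H`-periodic part `B₁ ∋ b₀`
    have hHtop : H ≠ ⊤ := by
      intro hT
      apply h.decomp_right.sub_notMem hb₀ hβ₀
      rw [hT]; exact AddSubgroup.mem_top _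
    haveI : Nontrivial (K ⧸ H) := by
      obtain ⟨g, hg⟩ : ∃ g : K, g ∉ H := by
        by_contra hno
        push Not at hno
        exact hHtop ((AddSubgroup.eq_top_iff' H).2 hno)
      exact nontrivial_of_ne (QuotientAddGroup.mk g) 0 fun e => hg ((QuotientAddGroup.eq_zero_iff g).1 e)
    -- the quotient is smaller
    have hlt : Fintype.card (K ⧸ H) < n := by
      have hmul := AddSubgroup.card_eq_card_quotient_mul_card_addSubgroup H
      rw [Nat.card_eq_fintype_card, Nat.card_eq_fintype_card, hn] at hmul
      have h1 : 1 < Nat.card H := (AddSubgroup.one_lt_card_iff_ne_bot H).2 h.decomp_left.ne_bot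
      have hpos : 0 < Fintype.card (K ⧸ H) := Fintype.card_pos
      have h2 : Fintype.card (K ⧸ H) * 2 ≤ Fintype.card (K ⧸ H) * Nat.card H :=
        Nat.mul_le_mul_left _ h1
      omega
    -- the pair in the quotient satisfies the hypotheses of KST
    have hcrit' : #(A.image (QuotientAddGroup.mk : K → K ⧸ H) + B.image (QuotientAddGroup.mk : K → K ⧸ H)) + 1 =
        #(A.image (QuotientAddGroup.mk : K → K ⧸ H)) + #(B.image (QuotientAddGroup.mk : K → K ⧸ H)) := by
      rw [← image_mk_add_eq, ← cosetCount_eq_card_image, ← cosetCount_eq_card_image,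
        ← cosetCount_eq_card_image, h.cosetCount_add]
    have hyp' : ¬ IsPeriodic (A.image (QuotientAddGroup.mk : K → K ⧸ H) +
          B.image (QuotientAddGroup.mk : K → K ⧸ H)) ∨
        ∃ c, (A.image (QuotientAddGroup.mk : K → K ⧸ H)).addConvolution
          (B.image (QuotientAddGroup.mk : K → K ⧸ H)) c = 1 :=
      Or.inr ⟨_, (quot_unique_iff_addConvolution_image h.decomp_left h.decomp_right ha₀A₀ hβ₀).1
        h.quot_unique⟩
    obtain ⟨N', X₁, X₀, Y₁, Y₀, hq⟩ :=
      ih _ hlt (K ⧸ H) rfl (hAne.image _) (hBne.image _) hcrit' hyp'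
    obtain ⟨N, B₁', B₀', hN⟩ := h.exists_isKempermanDecomp_lift hA₀ hb₀ hu hq
    exact ⟨N, A₁, {a₀}, B₁', B₀', hN⟩
  -- Kemperman's form
  obtain ⟨H, A₁, A₀, B₁, B₀, h⟩ := exists_isKempermanDecompI hA hB hcrit hyp
  by_cases hiii : ∀ a ∈ A, ∀ b ∈ B, A.addConvolution B (a + b) = 1 → a ∈ A₀ ∧ b ∈ B₀
  · exact ⟨H, A₁, A₀, B₁, B₀,
      { decomp_left := h.decomp_left
        decomp_right := h.decomp_right
        left_nonempty := h.left_nonempty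
        right_nonempty := h.right_nonempty
        quot_unique := h.quot_unique
        cosetCount_add := h.cosetCount_add
        mem_of_unique := hiii
        elementary := h.elementary }⟩
  · push Not at hiii
    obtain ⟨a, ha, b, hb, hu, hnot⟩ := hiii
    have haA : a ∈ A₁ ∪ A₀ := by rw [h.decomp_left.union_eq]; exact ha
    rcases mem_union.1 haA with ha₁ | ha₀
    · -- `a ∈ A₁`: then `B₀ = {b}`; work with the symmetric decomposition
      have hB₀ : B₀ = {b} := h.right_eq_singleton_of_unique ha₁ hb hu
      have hu' : B.addConvolution A (b + a) = 1 := by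
        rw [add_comm b a, Grynkiewicz2009.addConvolution_comm]; exact hu
      obtain ⟨N, X₁, X₀, Y₁, Y₀, hN⟩ := step h.symm hB₀ ha₁ hu'
      exact ⟨N, Y₁, Y₀, X₁, X₀, hN.symm⟩
    · -- `a ∈ A₀`: then `b ∈ B₁` and `A₀ = {a}`
      have hb₁ : b ∈ B₁ := by
        have hbB : b ∈ B₁ ∪ B₀ := by rw [h.decomp_right.union_eq]; exact hb
        exact (mem_union.1 hbB).resolve_right fun hb₀ => hnot ha₀ hb₀
      have hA₀ : A₀ = {a} := by
        have hu' : B.addConvolution A (b + a) = 1 := by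
          rw [add_comm b a, Grynkiewicz2009.addConvolution_comm]; exact hu
        exact h.symm.right_eq_singleton_of_unique hb₁ ha hu'
      exact step h hA₀ hb₁ hu

end Literature.Combinatorics.Additive
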